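import Summits.ValiantsHypothesis.ValiantsHypothesis.Theorems.BarrierLeverPartitionMinorsHitByVPSplittableClasses
import Summits.ValiantsHypothesis.ValiantsHypothesis.Theorems.BarrierLeverPartitionMinorsHitByVPOrProjections

/-!
# Route BarrierLever — item `PartitionMinorsHitByVP` (stmt-ValiantsHypothesis-19717):
# FACE rows × SPLITTABLE columns (the `x ↔ y` mirror)

Helper file (`--supports stmt-ValiantsHypothesis-19717`; cell valiant-natproofs, rung V4, 𝒟-side door (c),
prover seat val-np-p1 gen 9). Closes NO item; definition-free glue: the `x ↔ y` symmetry of item 19717's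
matrix (`AdditiveDoor.partitionMinor_hit_symm`, val-np-p6 g3, file `…OrProjections`) applied to
`SubsetSum.partitionMinor_hit_of_isSplittable_face` and its two class corollaries
(`…SplittableFaces`, `…SplittableClasses`, this seat):

* `partitionMinor_hit_of_face_isSplittable` — rows a `κ`-dimensional FACE `[U₀, U₀ ⊔ T]` of the Boolean
  lattice, columns ANY injective `IsSplittable κ` family: hit inside `SmallCircuits ℂ (h+h) 5`, `h ≥ 2`;
* `partitionMinor_hit_of_face_symmDiff_closed` — rows a face, columns a coset of a binary linear code
  (triple-`∆`-closed), UNCONDITIONAL;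
* `partitionMinor_hit_of_face_of_cubeHalving` — rows a face, columns arbitrary, CONDITIONAL on
  `CubeHalving h κ'` for `κ' ≤ κ`.

WHAT THIS IS NOT: nothing beyond faces on the structured side; nothing on crux 14610.
-/

set_option linter.dupNamespace false

namespace Summit.ValiantsHypothesis.ValiantsHypothesis.Theorems.BarrierLever.SubsetSum

open Finset MvPolynomial Literature.Barriers.ValiantsHypothesis
open scoped symmDiff
open Summit.ValiantsHypothesis.ValiantsHypothesis.Theorems.BarrierLever.AdditiveDoor (partitionMinor_hit_symm)

variable {h : ℕ}

/-- **FACE rows × SPLITTABLE columns are hit** (`h ≥ 2`, `b = 5`). -/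
theorem partitionMinor_hit_of_face_isSplittable (hh : 2 ≤ h) {κ : ℕ}
    (w : (Fin κ → Bool) → Finset (Fin h)) (hw : Function.Injective w) (hs : IsSplittable κ (univ.image w))
    (T : Fin κ ↪ Fin h) (U₀ : Finset (Fin h)) (hU₀ : ∀ c, T c ∉ U₀) :
    ∃ f ∈ SmallCircuits ℂ (h + h) 5,
      (Matrix.of fun i j : Fin κ → Bool => MvPolynomial.coeff
        (∑ a ∈ U₀ ∪ (univ.filter fun c => i c).map T, Finsupp.single (Fin.castAdd h a) 1 +
          ∑ c ∈ w j, Finsupp.single (Fin.natAdd h c) 1) f).det ≠ 0 :=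
  partitionMinor_hit_symm h 5 (fun i : Fin κ → Bool => U₀ ∪ (univ.filter fun c => i c).map T) w
    (partitionMinor_hit_of_isSplittable_face hh w hw hs T U₀ hU₀)

/-- **FACE rows × coset-of-a-code columns are hit** (unconditional). -/
theorem partitionMinor_hit_of_face_symmDiff_closed (hh : 2 ≤ h) {κ : ℕ}
    (w : (Fin κ → Bool) → Finset (Fin h)) (hw : Function.Injective w)
    (hΔ : ∀ i j k, w i ∆ w j ∆ w k ∈ univ.image w)
    (T : Fin κ ↪ Fin h) (U₀ : Finset (Fin h)) (hU₀ : ∀ c, T c ∉ U₀) :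
    ∃ f ∈ SmallCircuits ℂ (h + h) 5,
      (Matrix.of fun i j : Fin κ → Bool => MvPolynomial.coeff
        (∑ a ∈ U₀ ∪ (univ.filter fun c => i c).map T, Finsupp.single (Fin.castAdd h a) 1 +
          ∑ c ∈ w j, Finsupp.single (Fin.natAdd h c) 1) f).det ≠ 0 :=
  partitionMinor_hit_symm h 5 (fun i : Fin κ → Bool => U₀ ∪ (univ.filter fun c => i c).map T) w
    (partitionMinor_hit_of_symmDiff_closed_face hh w hw hΔ T U₀ hU₀)

/-- **FACE rows × arbitrary columns, conditional on CUBE HALVING.** -/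
theorem partitionMinor_hit_of_face_of_cubeHalving (hh : 2 ≤ h) {κ : ℕ} (H : ∀ κ' ≤ κ, CubeHalving h κ')
    (w : (Fin κ → Bool) → Finset (Fin h)) (hw : Function.Injective w)
    (T : Fin κ ↪ Fin h) (U₀ : Finset (Fin h)) (hU₀ : ∀ c, T c ∉ U₀) :
    ∃ f ∈ SmallCircuits ℂ (h + h) 5,
      (Matrix.of fun i j : Fin κ → Bool => MvPolynomial.coeff
        (∑ a ∈ U₀ ∪ (univ.filter fun c => i c).map T, Finsupp.single (Fin.castAdd h a) 1 +
          ∑ c ∈ w j, Finsupp.single (Fin.natAdd h c) 1) f).det ≠ 0 :=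
  partitionMinor_hit_symm h 5 (fun i : Fin κ → Bool => U₀ ∪ (univ.filter fun c => i c).map T) w
    (partitionMinor_hit_face_of_cubeHalving hh H w hw T U₀ hU₀)

end Summit.ValiantsHypothesis.ValiantsHypothesis.Theorems.BarrierLever.SubsetSum
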